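import Mathlib
import Summits.NavierStokesRegularity.NavierStokesRegularity.Theorems.EulerZoomLiouvillePowerGaugeEulerLiouvilleDSSVorticityDecayTools
import HarnessLib

/-!
# The SYMMETRY-FREE discretely self-similar stratum of the crux `EulerZoomLiouville.PowerGaugeEulerLiouville`
# with DECAYING vorticity (route №10, item stmt-NavierStokesRegularity-19832) — every `ρ > 0`

Helper file (theorems only; `--supports stmt-NavierStokesRegularity-19832`). Seat ns-typeII-p3 (cell
ns-regularity-ideate §B, D-0081). Rung C2 (discretely self-similar members) of
`Cruxes/PowerGaugeEulerLiouville/Lines/rungC_window.lean` WITHOUT any symmetry assumption.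

THE STRATUM (`ae_eq_zero_of_gauge_of_dss_vorticityDecay`; binder form
`powerGaugeEulerLiouville_dss_vorticityDecay`). A member `(u, p, H, c)` of Seregin's power-gauged ancient
Euler class (exponent `ρ > 0`; the crux's three hypotheses VERBATIM) which is a classical Euler solution on
the open slab, DISCRETELY SELF-SIMILAR for the class scaling with a factor `l > 1`
(`u(τ,y) = l^{1+ρ} u(l^{2+ρ}τ, l y)`), with bounded velocity and velocity gradient on compact time
intervals, and such that for ONE exponent `q > 0`
* `∫ |curl u(τ)|^q dy` is bounded on compact time intervals, and
* on a far region `|y| ≥ R₀ |τ|^{1/(2+ρ)}` the scale-invariant bounds `|τ| ‖∇u(τ,y)‖ ≤ δ` and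
  `|τ| |u(τ,y)| ≤ |y|/(2+ρ)` hold with `(1 − qδ(l^{2+ρ} − 1)) · l^{3 − q(2+ρ)} > 1`
  (so `q < 3/(2+ρ)` and `δ` small: every `q < 3/(2+ρ)` is admissible when `∇u → 0` at spatial infinity
  in the scale-invariant sense),
vanishes a.e. on the slab. The natural tail `|curl u| ~ |y|^{−(2+ρ)}` is exactly critical (`q(2+ρ) = 3`):
the stratum covers every vorticity tail strictly faster than natural, and nothing at the natural tail.

THE ARGUMENT (Chae–Tsai, MRL 21 (2014) Thm 2.2, ported to PHYSICAL variables, Eulerian, for Seregin's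
gauged class, with the class's `A`-gauge Liouville replacing their decay-of-`V` hypothesis). With the
moving exterior weight `W(τ,y) = ϑ(|y|²R₀⁻²|τ|^{−2/(2+ρ)} − 1)` and `J(τ) = ∫W(τ)²|curl u(τ)|^q`:
(i) SCALING `J(l^{2+ρ}τ) = l^{3−q(2+ρ)} J(τ)` (`integral_weight_rpow_dss`); (ii) DYNAMICS
`J(b) ≥ J(a) − (qδ/|b|)∫ₐᵇ J` (`weight_rpow_interval_ge`: weighted `q`-enstrophy inequality, the shells
`|y| = R|τ|^{1/(2+ρ)}` being outgoing); (iii) a supremum argument over one period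
(`integral_weight_rpow_eq_zero_of_dss`): `s = sup_{[l^{2+ρ}τ₀, τ₀]} J ≤ J(τ₀) + θ s`,
`θ = qδ(l^{2+ρ}−1)`, and `l^{3−q(2+ρ)}J(τ₀) = J(l^{2+ρ}τ₀) ≤ s`, so `((1−θ)l^{3−q(2+ρ)} − 1) J(τ₀) ≤ 0`,
i.e. `J ≡ 0`; (iv) hence `curl u(τ)` is supported in the ball `|y| ≤ √2 R₀|τ|^{1/(2+ρ)}`, a set of
finite measure bounded on compact time intervals, and the support stratum
`VorticitySupport.ae_eq_zero_of_gauge_of_dss_vorticitySupport` (Helmholtz conservation of the support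
measure vs. the `l⁻³` scaling, then the lead's `A`-gauge harmonic Liouville) finishes.

WHAT THIS IS NOT: not NS, not the crux E, not rung C2 whole — DSS members with the natural (critical)
vorticity tail, and all non-classical members, are untouched. [folklore]
-/

noncomputable section

-- the summit and its single problem share the name `NavierStokesRegularity` (D-0017 nested layout)
set_option linter.dupNamespace false

open Set Function Filter Topology MeasureTheory Metric Module
open scoped NNReal ENNReal InnerProductSpace RealInnerProductSpace

namespace Summit.NavierStokesRegularity.NavierStokesRegularity.Theorems.PowerGaugeEulerLiouville.VorticityDecay

open Literature.Analysis Literature.Analysis.FluidPDE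
open Summit.NavierStokesRegularity.NavierStokesRegularity.Theorems.PowerGaugeEulerLiouville
open Summit.NavierStokesRegularity.NavierStokesRegularity.Theorems.PowerGaugeEulerLiouville.AxisymNoSwirl
open Summit.NavierStokesRegularity.NavierStokesRegularity.Theorems.PowerGaugeEulerLiouville.VorticitySupport

/-- The weight slice `y ↦ W(τ, y)` is continuous. [folklore] -/
theorem continuous_weight_slice (R₀ n τ : ℝ) :
    Continuous fun y : EuclideanSpace ℝ (Fin 3) =>
      Real.smoothTransition (‖y‖ ^ 2 * ((R₀ ^ 2)⁻¹ * (-τ) ^ (-(2 * n))) - 1) :=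
  Real.smoothTransition.continuous.comp (((continuous_norm.pow 2).mul continuous_const).sub continuous_const)

/-- **The weighted `q`-power of the vorticity of a DSS member with far-field control vanishes identically**
(supremum argument over one period: scaling lever against dynamical lever). [folklore] -/
theorem integral_weight_rpow_eq_zero_of_dss {ρ : ℝ} (hρ : 0 < ρ)
    {u : ℝ → (EuclideanSpace ℝ (Fin 3)) → (EuclideanSpace ℝ (Fin 3))} {p : ℝ → (EuclideanSpace ℝ (Fin 3)) → ℝ}
    (hns : IsClassicalNSSolutionOn (Iio 0) 0 0 u p)
    {l : ℝ} (hl : 1 < l)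
    (hdss : ∀ τ : ℝ, τ < 0 → ∀ y, u τ y = (l ^ (1 + ρ)) • u ((l ^ (2 + ρ)) * τ) (l • y))
    (hbdd : ∀ s t : ℝ, s < t → t < 0 → ∃ B : ℝ, ∀ τ ∈ Icc s t, ∀ y,
      ‖u τ y‖ ≤ B ∧ ‖fderiv ℝ (u τ) y‖ ≤ B)
    {q R₀ δ : ℝ} (hq : 0 < q) (hR : 0 < R₀) (hδ : 0 ≤ δ)
    (hLq : ∀ s t : ℝ, s < t → t < 0 → ∃ N : ℝ, ∀ τ ∈ Icc s t,
      Integrable (fun y => ‖curl (u τ) y‖ ^ q) ∧ ∫ y, ‖curl (u τ) y‖ ^ q ≤ N)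
    (hfar : ∀ τ : ℝ, τ < 0 → ∀ y : EuclideanSpace ℝ (Fin 3), R₀ * (-τ) ^ (2 + ρ)⁻¹ ≤ ‖y‖ →
      (-τ) * ‖fderiv ℝ (u τ) y‖ ≤ δ ∧ (-τ) * ‖u τ y‖ ≤ (2 + ρ)⁻¹ * ‖y‖)
    (hsmall : 1 < (1 - q * δ * (l ^ (2 + ρ) - 1)) * l ^ (3 - q * (2 + ρ)))
    {τ₀ : ℝ} (hτ₀ : τ₀ < 0) :
    ∫ y, Real.smoothTransition (‖y‖ ^ 2 * ((R₀ ^ 2)⁻¹ * (-τ₀) ^ (-(2 * (2 + ρ)⁻¹))) - 1) ^ 2 *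
      ‖curl (u τ₀) y‖ ^ q = 0 := by
  have hρ2 : 0 < 2 + ρ := by linarith
  have hl0 : 0 < l := zero_lt_one.trans hl
  have hL1 : 1 < l ^ (2 + ρ) := Real.one_lt_rpow hl (by linarith)
  set τ₁ : ℝ := l ^ (2 + ρ) * τ₀ with hτ₁
  have hτ₁τ₀ : τ₁ < τ₀ := by
    have : τ₁ - τ₀ = (l ^ (2 + ρ) - 1) * τ₀ := by rw [hτ₁]; ring
    nlinarith
  have hτ₁0 : τ₁ < 0 := hτ₁τ₀.trans hτ₀
  obtain ⟨B, hB⟩ := hbdd τ₁ τ₀ hτ₁τ₀ hτ₀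
  obtain ⟨N, hN⟩ := hLq τ₁ τ₀ hτ₁τ₀ hτ₀
  -- the weighted `q`-power as a function of time
  set J : ℝ → ℝ := fun τ => ∫ y, Real.smoothTransition (‖y‖ ^ 2 *
    ((R₀ ^ 2)⁻¹ * (-τ) ^ (-(2 * (2 + ρ)⁻¹))) - 1) ^ 2 * ‖curl (u τ) y‖ ^ q with hJ
  have hJ0 : ∀ τ, 0 ≤ J τ := fun τ =>
    integral_nonneg fun y => mul_nonneg (sq_nonneg _) (Real.rpow_nonneg (norm_nonneg _) _)
  have hJN : ∀ τ ∈ Icc τ₁ τ₀, J τ ≤ N := by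
    intro τ hτ
    have hW1 : ∀ y : EuclideanSpace ℝ (Fin 3), Real.smoothTransition (‖y‖ ^ 2 *
        ((R₀ ^ 2)⁻¹ * (-τ) ^ (-(2 * (2 + ρ)⁻¹))) - 1) ^ 2 ≤ 1 := fun y =>
      pow_le_one₀ (Real.smoothTransition.nonneg _) (Real.smoothTransition.le_one _)
    have hI : Integrable (fun y => Real.smoothTransition (‖y‖ ^ 2 *
        ((R₀ ^ 2)⁻¹ * (-τ) ^ (-(2 * (2 + ρ)⁻¹))) - 1) ^ 2 * ‖curl (u τ) y‖ ^ q) :=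
      (hN τ hτ).1.bdd_mul ((continuous_weight_slice R₀ _ τ).pow 2).aestronglyMeasurable
        (Eventually.of_forall fun y => by
          rw [Real.norm_of_nonneg (sq_nonneg _)]; exact hW1 y)
    refine (integral_mono hI (hN τ hτ).1 fun y => ?_).trans (hN τ hτ).2
    have h0 : 0 ≤ ‖curl (u τ) y‖ ^ q := Real.rpow_nonneg (norm_nonneg _) _
    simpa using mul_le_mul_of_nonneg_right (hW1 y) h0
  -- the supremum over one period
  have hbdd' : BddAbove (J '' Icc τ₁ τ₀) := ⟨N, by rintro _ ⟨τ, hτ, rfl⟩; exact hJN τ hτ⟩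
  set s : ℝ := sSup (J '' Icc τ₁ τ₀) with hs
  have hτ₀m : τ₀ ∈ Icc τ₁ τ₀ := ⟨hτ₁τ₀.le, le_rfl⟩
  have hτ₁m : τ₁ ∈ Icc τ₁ τ₀ := ⟨le_rfl, hτ₁τ₀.le⟩
  have hle_s : ∀ τ ∈ Icc τ₁ τ₀, J τ ≤ s := fun τ hτ => le_csSup hbdd' ⟨τ, hτ, rfl⟩
  have hs0 : 0 ≤ s := (hJ0 τ₀).trans (hle_s τ₀ hτ₀m)
  set θ : ℝ := q * δ * (l ^ (2 + ρ) - 1) with hθ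
  have hθ0 : 0 ≤ θ := by rw [hθ]; exact mul_nonneg (mul_nonneg hq.le hδ) (by linarith)
  -- dynamical lever: `J σ ≤ J τ₀ + θ s` on the period
  have hdyn : ∀ σ ∈ Icc τ₁ τ₀, J σ ≤ J τ₀ + θ * s := by
    intro σ hσ
    rcases eq_or_lt_of_le hσ.2 with h | hστ₀
    · rw [h]; nlinarith
    have hsub : Icc σ τ₀ ⊆ Icc τ₁ τ₀ := Icc_subset_Icc hσ.1 le_rfl
    have hineq := weight_rpow_interval_ge (R₀ := R₀) hρ2 hR hδ hq hστ₀ hτ₀ hns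
      (fun τ hτ => hB τ (hsub hτ)) (fun τ hτ => hN τ (hsub hτ)) hfar
    -- the time integral of `J(· + σ)` over `(0, τ₀ - σ)` is at most `(τ₀ - σ) s`
    have hint : ∫ r in Ioo 0 (τ₀ - σ), J (r + σ) ≤ (τ₀ - σ) * s := by
      by_cases hi : IntegrableOn (fun r => J (r + σ)) (Ioo 0 (τ₀ - σ))
      · have hmono := setIntegral_mono_on hi (integrableOn_const (C := s) (by simp)) measurableSet_Ioo
          (fun r hr => hle_s (r + σ) ⟨by linarith [hr.1, hσ.1], by linarith [hr.2]⟩)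
        refine hmono.trans_eq ?_
        rw [setIntegral_const, Real.volume_real_Ioo_of_le (by linarith), sub_zero, smul_eq_mul]
      · rw [integral_undef hi]; nlinarith
    have hfac : q * (δ / -τ₀) * ((τ₀ - σ) * s) ≤ θ * s := by
      have h1 : τ₀ - σ ≤ τ₀ - τ₁ := by linarith [hσ.1]
      have h2 : q * (δ / -τ₀) * ((τ₀ - σ) * s) ≤ q * (δ / -τ₀) * ((τ₀ - τ₁) * s) := by
        have : 0 ≤ q * (δ / -τ₀) := mul_nonneg hq.le (div_nonneg hδ (by linarith))
        exact mul_le_mul_of_nonneg_left (mul_le_mul_of_nonneg_right h1 hs0) this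
      have h3 : q * (δ / -τ₀) * ((τ₀ - τ₁) * s) = θ * s := by
        have hne : τ₀ ≠ 0 := hτ₀.ne
        rw [hθ, hτ₁, show τ₀ - l ^ (2 + ρ) * τ₀ = (-τ₀) * (l ^ (2 + ρ) - 1) by ring]
        field_simp
      linarith
    have hJσ : J σ - q * (δ / -τ₀) * ∫ r in Ioo 0 (τ₀ - σ), J (r + σ) ≤ J τ₀ := by
      simpa only [hJ] using hineq
    have : q * (δ / -τ₀) * (∫ r in Ioo 0 (τ₀ - σ), J (r + σ)) ≤ θ * s :=
      (mul_le_mul_of_nonneg_left hint (mul_nonneg hq.le (div_nonneg hδ (by linarith)))).trans hfac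
    linarith
  have hsle : s ≤ J τ₀ + θ * s :=
    csSup_le (Set.Nonempty.image _ ⟨τ₀, hτ₀m⟩) (by rintro _ ⟨τ, hτ, rfl⟩; exact hdyn τ hτ)
  -- scaling lever: `J τ₁ = l^{3 - q(2+ρ)} J τ₀`
  have hd : Differentiable ℝ (u (l ^ (2 + ρ) * τ₀)) :=
    (hns.contDiff_velocity hτ₁0).differentiable (by simp)
  have hscal := integral_weight_rpow_dss (R₀ := R₀) (q := q) hρ2 hl0 hτ₀ hd (hdss τ₀ hτ₀)
  have hscal' : J τ₀ = (l ^ (2 + ρ)) ^ q * (l ^ 3)⁻¹ * J τ₁ := by simpa only [hJ] using hscal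
  set L : ℝ := l ^ (3 - q * (2 + ρ)) with hL
  have hLpos : 0 < L := Real.rpow_pos_of_pos hl0 _
  have hJ1 : J τ₁ = L * J τ₀ := by
    rw [hscal', hL]
    have := dss_scaling_factor_mul (ρ := ρ) (q := q) hl0
    calc J τ₁ = ((l ^ (2 + ρ)) ^ q * (l ^ 3)⁻¹ * l ^ (3 - q * (2 + ρ))) * J τ₁ := by rw [this, one_mul]
      _ = _ := by ring
  have hLJ : L * J τ₀ ≤ s := hJ1 ▸ hle_s τ₁ hτ₁m
  -- conclude
  have hθ1 : θ < 1 := by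
    by_contra h
    have : (1 - θ) * L ≤ 0 := mul_nonpos_of_nonpos_of_nonneg (by linarith) hLpos.le
    rw [hθ, hL] at this
    linarith
  have hkey : ((1 - θ) * L - 1) * J τ₀ ≤ 0 := by nlinarith [hJ0 τ₀]
  have hpos : 0 < (1 - θ) * L - 1 := by rw [hθ, hL]; linarith
  have : J τ₀ ≤ 0 := by
    by_contra hcon
    have : 0 < ((1 - θ) * L - 1) * J τ₀ := mul_pos hpos (lt_of_not_ge hcon)
    linarith
  exact le_antisymm this (hJ0 τ₀)

/-- **Where the weighted `q`-power vanishes, the vorticity vanishes off the ball `|y|² ≥ 2R₀²|τ|^{2/(2+ρ)}`**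
(the integrand is continuous, nonnegative and integrable; the weight equals `1` there). [folklore] -/
theorem curl_eq_zero_of_integral_weight_rpow_eq_zero {ρ q R₀ τ : ℝ} (hq : 0 < q) (hR : 0 < R₀) (hτ : τ < 0)
    {u : ℝ → (EuclideanSpace ℝ (Fin 3)) → (EuclideanSpace ℝ (Fin 3))} (hu : ContDiff ℝ 2 (u τ))
    (hI : Integrable (fun y => ‖curl (u τ) y‖ ^ q))
    (hJ : ∫ y, Real.smoothTransition (‖y‖ ^ 2 * ((R₀ ^ 2)⁻¹ * (-τ) ^ (-(2 * (2 + ρ)⁻¹))) - 1) ^ 2 *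
      ‖curl (u τ) y‖ ^ q = 0)
    {y : EuclideanSpace ℝ (Fin 3)} (hy : 2 * (R₀ ^ 2 * (-τ) ^ (2 * (2 + ρ)⁻¹)) ≤ ‖y‖ ^ 2) :
    curl (u τ) y = 0 := by
  have hτ' : 0 < -τ := by linarith
  have hωc : Continuous (curl (u τ)) := (contDiff_curl (n := 1) (hu.of_le (by norm_num))).continuous
  have hFc : Continuous fun y : EuclideanSpace ℝ (Fin 3) =>
      Real.smoothTransition (‖y‖ ^ 2 * ((R₀ ^ 2)⁻¹ * (-τ) ^ (-(2 * (2 + ρ)⁻¹))) - 1) ^ 2 * ‖curl (u τ) y‖ ^ q :=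
    ((continuous_weight_slice R₀ _ τ).pow 2).mul (hωc.norm.rpow_const fun _ => Or.inr hq.le)
  have hF0 : ∀ y : EuclideanSpace ℝ (Fin 3), 0 ≤
      Real.smoothTransition (‖y‖ ^ 2 * ((R₀ ^ 2)⁻¹ * (-τ) ^ (-(2 * (2 + ρ)⁻¹))) - 1) ^ 2 * ‖curl (u τ) y‖ ^ q :=
    fun y => mul_nonneg (sq_nonneg _) (Real.rpow_nonneg (norm_nonneg _) _)
  have hFI : Integrable fun y : EuclideanSpace ℝ (Fin 3) =>
      Real.smoothTransition (‖y‖ ^ 2 * ((R₀ ^ 2)⁻¹ * (-τ) ^ (-(2 * (2 + ρ)⁻¹))) - 1) ^ 2 * ‖curl (u τ) y‖ ^ q :=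
    hI.bdd_mul ((continuous_weight_slice R₀ _ τ).pow 2).aestronglyMeasurable
      (Eventually.of_forall fun y => by
        rw [Real.norm_of_nonneg (sq_nonneg _)]
        exact pow_le_one₀ (Real.smoothTransition.nonneg _) (Real.smoothTransition.le_one _))
  have hae := (integral_eq_zero_iff_of_nonneg hF0 hFI).1 hJ
  have hzero := (hFc.ae_eq_iff_eq volume continuous_const).1 hae
  have hFy := congrFun hzero y
  -- the weight equals `1` at `y`
  have hW1 : Real.smoothTransition (‖y‖ ^ 2 * ((R₀ ^ 2)⁻¹ * (-τ) ^ (-(2 * (2 + ρ)⁻¹))) - 1) = 1 := by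
    apply Real.smoothTransition.one_of_one_le
    have hP : 0 < R₀ ^ 2 * (-τ) ^ (2 * (2 + ρ)⁻¹) := by positivity
    rw [Real.rpow_neg hτ'.le, ← mul_inv, le_sub_iff_add_le, ← div_eq_mul_inv, le_div_iff₀ hP]
    linarith
  simp only [hW1, one_pow, one_mul] at hFy
  have h := (Real.rpow_eq_zero_iff_of_nonneg (norm_nonneg (curl (u τ) y))).1 hFy
  exact norm_eq_zero.1 h.1

/-- **The DSS stratum of the crux `PowerGaugeEulerLiouville` with DECAYING vorticity** (every `ρ > 0`;
rung C2 of `Lines/rungC_window.lean`, NO symmetry; conditional on classical regularity, bounded `u`/`∇u`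
and bounded `∫|curl u|^q` on compact time intervals, and the scale-invariant far-field bounds with
`(1 − qδ(l^{2+ρ}−1)) · l^{3−q(2+ρ)} > 1`). Port of Chae–Tsai, MRL 21 (2014) Thm 2.2 to physical variables
and Seregin's gauged class. [folklore] -/
theorem ae_eq_zero_of_gauge_of_dss_vorticityDecay {ρ : ℝ} (hρ : 0 < ρ)
    {u : ℝ → (EuclideanSpace ℝ (Fin 3)) → (EuclideanSpace ℝ (Fin 3))} {p : ℝ → (EuclideanSpace ℝ (Fin 3)) → ℝ}
    {H : ℝ → (EuclideanSpace ℝ (Fin 3)) → (EuclideanSpace ℝ (Fin 3)) →L[ℝ] (EuclideanSpace ℝ (Fin 3))} {c : ℝ≥0}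
    (hH : HasWeakSpatialGradientOn (slab (EuclideanSpace ℝ (Fin 3)) (Iio 0) isOpen_Iio) u H)
    (hc : ∀ a : ℝ, 0 < a → ENNReal.ofReal (a ^ (2 * ρ)) * cknA a (0 : ℝ × (EuclideanSpace ℝ (Fin 3))) u +
        ENNReal.ofReal (a ^ ρ) * cknE a (0 : ℝ × (EuclideanSpace ℝ (Fin 3))) H +
        ENNReal.ofReal (a ^ (2 * ρ)) * cknD a (0 : ℝ × (EuclideanSpace ℝ (Fin 3))) p ≤ (c : ℝ≥0∞))
    (hns : IsClassicalNSSolutionOn (Iio 0) 0 0 u p)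
    {l : ℝ} (hl : 1 < l)
    (hdss : ∀ τ : ℝ, τ < 0 → ∀ y, u τ y = (l ^ (1 + ρ)) • u ((l ^ (2 + ρ)) * τ) (l • y))
    (hbdd : ∀ s t : ℝ, s < t → t < 0 → ∃ B : ℝ, ∀ τ ∈ Icc s t, ∀ y,
      ‖u τ y‖ ≤ B ∧ ‖fderiv ℝ (u τ) y‖ ≤ B)
    {q R₀ δ : ℝ} (hq : 0 < q) (hR : 0 < R₀) (hδ : 0 ≤ δ)
    (hLq : ∀ s t : ℝ, s < t → t < 0 → ∃ N : ℝ, ∀ τ ∈ Icc s t,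
      Integrable (fun y => ‖curl (u τ) y‖ ^ q) ∧ ∫ y, ‖curl (u τ) y‖ ^ q ≤ N)
    (hfar : ∀ τ : ℝ, τ < 0 → ∀ y : EuclideanSpace ℝ (Fin 3), R₀ * (-τ) ^ (2 + ρ)⁻¹ ≤ ‖y‖ →
      (-τ) * ‖fderiv ℝ (u τ) y‖ ≤ δ ∧ (-τ) * ‖u τ y‖ ≤ (2 + ρ)⁻¹ * ‖y‖)
    (hsmall : 1 < (1 - q * δ * (l ^ (2 + ρ) - 1)) * l ^ (3 - q * (2 + ρ))) :
    uncurry u =ᵐ[volume.restrict (Iio (0 : ℝ) ×ˢ (univ : Set (EuclideanSpace ℝ (Fin 3))))] 0 := by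
  have hρ2 : 0 < 2 + ρ := by linarith
  have hn : 0 ≤ 2 * (2 + ρ)⁻¹ := by positivity
  -- every slice: vorticity supported in the ball `|y|² < 2R₀²|τ|^{2/(2+ρ)}`
  have hfarcurl : ∀ τ : ℝ, τ < 0 → ∀ y : EuclideanSpace ℝ (Fin 3), curl (u τ) y ≠ 0 →
      ‖y‖ ^ 2 < 2 * (R₀ ^ 2 * (-τ) ^ (2 * (2 + ρ)⁻¹)) := by
    intro τ hτ y hy
    by_contra hcon
    obtain ⟨N, hN⟩ := hLq (τ - 1) τ (by linarith) hτ
    have hJ := integral_weight_rpow_eq_zero_of_dss hρ hns hl hdss hbdd hq hR hδ hLq hfar hsmall hτ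
    exact hy (curl_eq_zero_of_integral_weight_rpow_eq_zero hq hR hτ
      ((hns.contDiff_velocity hτ).of_le (by norm_cast)) (hN τ ⟨by linarith, le_rfl⟩).1 hJ (not_lt.1 hcon))
  -- hence the support measure is bounded on compact time intervals
  have hsupp : ∀ s t : ℝ, s < t → t < 0 → ∃ N : ℝ≥0, ∀ τ ∈ Icc s t,
      volume {y | curl (u τ) y ≠ 0} ≤ N := by
    intro s t hst ht
    set r : ℝ := Real.sqrt (2 * (R₀ ^ 2 * (-s) ^ (2 * (2 + ρ)⁻¹))) with hr
    have hV : volume (closedBall (0 : EuclideanSpace ℝ (Fin 3)) r) ≠ ⊤ :=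
      (isCompact_closedBall _ _).measure_lt_top.ne
    refine ⟨(volume (closedBall (0 : EuclideanSpace ℝ (Fin 3)) r)).toNNReal, fun τ hτ => ?_⟩
    rw [ENNReal.coe_toNNReal hV]
    refine measure_mono fun y hy => ?_
    have hτ0 : τ < 0 := hτ.2.trans_lt ht
    have h1 := hfarcurl τ hτ0 y hy
    have hmono : (-τ) ^ (2 * (2 + ρ)⁻¹) ≤ (-s) ^ (2 * (2 + ρ)⁻¹) :=
      Real.rpow_le_rpow (by linarith) (by linarith [hτ.1]) hn
    have h2 : ‖y‖ ^ 2 < 2 * (R₀ ^ 2 * (-s) ^ (2 * (2 + ρ)⁻¹)) := by nlinarith [sq_nonneg R₀]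
    rw [mem_closedBall_zero_iff, hr]
    exact (Real.lt_sqrt (norm_nonneg _)).2 h2 |>.le
  exact ae_eq_zero_of_gauge_of_dss_vorticitySupport hρ hH hc hns hl hdss hbdd hsupp

/-- **The stratum in the crux's binder shape**: the crux `PowerGaugeEulerLiouville` VERBATIM with the extra
hypotheses «classical on the open slab, DSS with factor `l > 1`, bounded `u`/`∇u` and bounded
`∫|curl u(τ)|^q` on compact time intervals for one `q > 0`, and the scale-invariant far-field bounds
`|τ| ‖∇u‖ ≤ δ`, `|τ| |u| ≤ |y|/(2+ρ)` on `|y| ≥ R₀|τ|^{1/(2+ρ)}` with `(1 − qδ(l^{2+ρ}−1)) l^{3−q(2+ρ)} > 1»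
— NO symmetry. [folklore] -/
theorem powerGaugeEulerLiouville_dss_vorticityDecay :
    ∀ ρ : ℝ, 0 < ρ → ∀ (u : ℝ → EuclideanSpace ℝ (Fin 3) → EuclideanSpace ℝ (Fin 3))
      (p : ℝ → EuclideanSpace ℝ (Fin 3) → ℝ)
      (H : ℝ → EuclideanSpace ℝ (Fin 3) → EuclideanSpace ℝ (Fin 3) →L[ℝ] EuclideanSpace ℝ (Fin 3)) (c : ℝ≥0)
      (l q R₀ δ : ℝ),
      IsSuitableWeakSolutionOn (slab (EuclideanSpace ℝ (Fin 3)) (Iio 0) isOpen_Iio) 0 0 u p →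
      HasWeakSpatialGradientOn (slab (EuclideanSpace ℝ (Fin 3)) (Iio 0) isOpen_Iio) u H →
      (∀ a : ℝ, 0 < a → ENNReal.ofReal (a ^ (2 * ρ)) * cknA a (0 : ℝ × EuclideanSpace ℝ (Fin 3)) u +
        ENNReal.ofReal (a ^ ρ) * cknE a (0 : ℝ × EuclideanSpace ℝ (Fin 3)) H +
        ENNReal.ofReal (a ^ (2 * ρ)) * cknD a (0 : ℝ × EuclideanSpace ℝ (Fin 3)) p ≤ (c : ℝ≥0∞)) →
      IsClassicalNSSolutionOn (Iio 0) 0 0 u p →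
      1 < l →
      (∀ τ : ℝ, τ < 0 → ∀ y, u τ y = (l ^ (1 + ρ)) • u ((l ^ (2 + ρ)) * τ) (l • y)) →
      (∀ s t : ℝ, s < t → t < 0 → ∃ B : ℝ, ∀ τ ∈ Icc s t, ∀ y,
        ‖u τ y‖ ≤ B ∧ ‖fderiv ℝ (u τ) y‖ ≤ B) →
      0 < q → 0 < R₀ → 0 ≤ δ →
      (∀ s t : ℝ, s < t → t < 0 → ∃ N : ℝ, ∀ τ ∈ Icc s t,
        Integrable (fun y => ‖curl (u τ) y‖ ^ q) ∧ ∫ y, ‖curl (u τ) y‖ ^ q ≤ N) →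
      (∀ τ : ℝ, τ < 0 → ∀ y : EuclideanSpace ℝ (Fin 3), R₀ * (-τ) ^ (2 + ρ)⁻¹ ≤ ‖y‖ →
        (-τ) * ‖fderiv ℝ (u τ) y‖ ≤ δ ∧ (-τ) * ‖u τ y‖ ≤ (2 + ρ)⁻¹ * ‖y‖) →
      1 < (1 - q * δ * (l ^ (2 + ρ) - 1)) * l ^ (3 - q * (2 + ρ)) →
      Function.uncurry u =ᵐ[volume.restrict (Iio (0 : ℝ) ×ˢ (univ : Set (EuclideanSpace ℝ (Fin 3))))] 0 :=
  fun _ hρ _ _ _ _ _ _ _ _ _ hH hc hns hl hdss hbdd hq hR hδ hLq hfar hsmall =>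
    ae_eq_zero_of_gauge_of_dss_vorticityDecay hρ hH hc hns hl hdss hbdd hq hR hδ hLq hfar hsmall

/-- The stratum is a literal sub-case of the crux: `PowerGaugeEulerLiouville` implies it (so it is strictly
inside E, never summit-strength). [folklore] -/
theorem dss_vorticityDecay_of_powerGaugeEulerLiouville
    (h : Summit.NavierStokesRegularity.NavierStokesRegularity.Theses.EulerZoomLiouville.PowerGaugeEulerLiouville) :
    ∀ ρ : ℝ, 0 < ρ → ∀ (u : ℝ → EuclideanSpace ℝ (Fin 3) → EuclideanSpace ℝ (Fin 3))
      (p : ℝ → EuclideanSpace ℝ (Fin 3) → ℝ)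
      (H : ℝ → EuclideanSpace ℝ (Fin 3) → EuclideanSpace ℝ (Fin 3) →L[ℝ] EuclideanSpace ℝ (Fin 3)) (c : ℝ≥0),
      IsSuitableWeakSolutionOn (slab (EuclideanSpace ℝ (Fin 3)) (Iio 0) isOpen_Iio) 0 0 u p →
      HasWeakSpatialGradientOn (slab (EuclideanSpace ℝ (Fin 3)) (Iio 0) isOpen_Iio) u H →
      (∀ a : ℝ, 0 < a → ENNReal.ofReal (a ^ (2 * ρ)) * cknA a (0 : ℝ × EuclideanSpace ℝ (Fin 3)) u +
        ENNReal.ofReal (a ^ ρ) * cknE a (0 : ℝ × EuclideanSpace ℝ (Fin 3)) H +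
        ENNReal.ofReal (a ^ (2 * ρ)) * cknD a (0 : ℝ × EuclideanSpace ℝ (Fin 3)) p ≤ (c : ℝ≥0∞)) →
      Function.uncurry u =ᵐ[volume.restrict (Iio (0 : ℝ) ×ˢ (univ : Set (EuclideanSpace ℝ (Fin 3))))] 0 :=
  fun ρ hρ u p H c hsw hH hc => h ρ hρ u p H c hsw hH hc

end Summit.NavierStokesRegularity.NavierStokesRegularity.Theorems.PowerGaugeEulerLiouville.VorticityDecay

end
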